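import Literature.NumberTheory.EllipticCurves.GoodReductionInertia
import Mathlib.FieldTheory.IsAlgClosed.Basic
import Mathlib.Algebra.Polynomial.Lifts
import HarnessLib

/-!
# The kernel of reduction is divisible by integers prime to `p`, over an algebraically closed valued field

(Silverman, *AEC* IV.3.2(b) with IV.2.3(b), VII.2.2: `[m] : E₁(K) ⥲ E₁(K)` for `m ∈ R^*`.)

`Proofs`-style file (theorems only).  Let `(L, w)` be a valued field (`w : Valuation L ℝ≥0`)
which is **algebraically closed**, `V` a Weierstrass equation over `L` with `w`-integral
coefficients (Mathlib `WeierstrassCurve.IsIntegral w.integer`) which is an elliptic curve, and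
`m ∈ ℤ` with `|m| = 1`.  The *kernel of reduction* `E₁(L)` is the set of points `O` and `(x, y)`
with `w x > 1` (Silverman, *AEC* VII.§2; tree `Literature.NumberTheory.EllipticCurves.IsIntegralPoint`, `WeierstrassCurve.ReducesToZero`).
We prove

* `Literature.NumberTheory.EllipticCurves.exists_zsmul_eq_of_one_lt_val` — **`E₁(L)` is `m`-divisible inside `E₁(L)`**: for
  `P = (x, y)` with `w x > 1` there is `Q = (x', y')` with `w x' > 1` and `m • Q = P`.

In *AEC* this is a consequence of the formal group: for a field `K` complete with respect to a
discrete valuation, `E₁(K) ≅ Ê(𝓜)` (Prop. VII.2.2) and `[m]` is an automorphism of the formal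
group `Ê/R` for `m ∈ R^*` (Prop. IV.2.3(b)), "so it induces an isomorphism `[m] : Ê(𝓜) ⥲ Ê(𝓜)`"
(proof of Prop. IV.3.2(b), PDF p. 116); for the algebraically closed `L = K̄_v` one applies this
over the complete fields `K_v(P, Q)`.  Here we give a direct proof by **division polynomials**,
in the spirit of the tree's `Literature.NumberTheory.EllipticCurves.val_le_one_of_zsmul_eq_zero` (`GoodReductionInertia`, the
torsion-freeness half `E₁[m] = 0` of the same statement): the `x`-coordinate `x'` of an `m`-th
"root" of `P` is a root of `F(X) = Φₘ(X) - x · ΨSqₘ(X)` (`x([m]Q) = Φₘ(x_Q)/ΨSqₘ(x_Q)`,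
Silverman Ex. 3.7(d), tree `zsmul_some_eq_some_φ_div`), a polynomial of degree `m²` whose two
dominant coefficients at a point of size `w x` are `1` (from `Φₘ = X^{m²} + …`) and `-m² x` (from
`ΨSqₘ = m² X^{m²-1} + …`); after the substitution `X = x S` and division by `x^{m²}` one gets a
`w`-integral polynomial `H(S)` with reduction `S^{m²-1}(S - m²)`, whose simple root `S = m²` of
the reduction lifts to a root `s` with `|s| = 1` because `L` is algebraically closed
(`Literature.NumberTheory.EllipticCurves.exists_root_val_sub_lt_one`: over an algebraically closed valued field every root of the
reduction of an integral polynomial lifts — the valuation ring is henselian); then `x' = x s` has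
`w x' = w x > 1`, `ΨSqₘ(x') ≠ 0` (dominant term), so `x([m]Q) = x` for any `Q = (x', y')` on the
curve, i.e. `[m]Q = ±P`.

## References

* J. H. Silverman, *The Arithmetic of Elliptic Curves*, 2nd ed. (2009): Prop. IV.2.3(b),
  Prop. IV.3.2(b) and its first proof (PDF p. 116), Prop. VII.2.2 (PDF p. 170), Prop. VII.3.1,
  Exercise 3.7(d). [SilvermanAEC2009]

## Design

No definitions, no `sorry`; `noncomputable section`, `open scoped Classical NNReal`; one
universe `u` (`L : Type u`) as in `GoodReductionInertia`/`PointReduction`.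
-/

noncomputable section

open scoped Classical NNReal
open Polynomial WeierstrassCurve

universe u

namespace Literature.NumberTheory.EllipticCurves

variable {L : Type u} [Field L] {w : Valuation L ℝ≥0}

/-! ## Integral polynomials over a valued field: the quotient by a linear factor -/

/-- If `H = (X - r) · H₁` with `w r ≤ 1` and `H` has `w`-integral coefficients, then so has `H₁`
(synthetic division: `H₁ = H /ₘ (X - r)` is computed inside the valuation ring). [folklore] -/
theorem val_coeff_divByMonic_X_sub_C_le_one {H : L[X]} (hH : ∀ i, w (H.coeff i) ≤ 1) {r : L}
    (hr : w r ≤ 1) (i : ℕ) : w ((H /ₘ (X - C r)).coeff i) ≤ 1 := by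
  -- lift `H` and `X - r` to the valuation ring
  have hlift : H ∈ Polynomial.lifts (algebraMap w.integer L) := by
    rw [lifts_iff_coeff_lifts]
    intro n
    exact ⟨⟨H.coeff n, hH n⟩, rfl⟩
  obtain ⟨H₀, hH₀⟩ := (mem_lifts _).mp hlift
  have hXr : (X - C (⟨r, hr⟩ : w.integer)).map (algebraMap w.integer L) = X - C r := by
    rw [Polynomial.map_sub, map_X, map_C]; rfl
  have hmonic : (X - C (⟨r, hr⟩ : w.integer)).Monic := monic_X_sub_C _
  have key : H /ₘ (X - C r) = (H₀ /ₘ (X - C (⟨r, hr⟩ : w.integer))).map (algebraMap w.integer L) := by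
    rw [map_divByMonic _ hmonic, hH₀, hXr]
  rw [key, coeff_map]
  exact ((H₀ /ₘ (X - C (⟨r, hr⟩ : w.integer))).coeff i).2

/-! ## Root lifting over an algebraically closed valued field -/

/-- **The valuation ring of an algebraically closed valued field is henselian** (in the form
needed here): let `H ∈ L[X]` have `w`-integral coefficients, not all in the maximal ideal, and let
`s₀` with `w s₀ ≤ 1` be an approximate root, `w (H(s₀)) < 1` (i.e. `s̄₀` is a root of the
reduction `H̄ ≠ 0`).  If `L` is algebraically closed there is an exact root `s`, `H(s) = 0`, with
`w s ≤ 1` and `w (s - s₀) < 1`.  Proof by induction on the degree, splitting off a root `r` of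
`H`: if `w r ≤ 1` then either `r̄ = s̄₀` or `s̄₀` is a root of the reduction of `H / (X - r)`; if
`w r > 1` then `H = (1 - r⁻¹ X) · G` with `G` integral, `Ḡ = H̄`, and every root of `G` is a root
of `H`. [folklore] -/
theorem exists_root_val_sub_lt_one [IsAlgClosed L] :
    ∀ (n : ℕ) (H : L[X]), H.natDegree ≤ n → (∀ i, w (H.coeff i) ≤ 1) → (∃ i, w (H.coeff i) = 1) →
      ∀ s₀ : L, w s₀ ≤ 1 → w (H.eval s₀) < 1 →
        ∃ s : L, w s ≤ 1 ∧ w (s - s₀) < 1 ∧ H.eval s = 0 := by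
  intro n
  induction n with
  | zero =>
    intro H hdeg hint hunit s₀ hs₀ hHs₀
    exfalso
    obtain ⟨i, hi⟩ := hunit
    rw [Nat.le_zero] at hdeg
    have hC : H = C (H.coeff 0) := eq_C_of_natDegree_eq_zero hdeg
    rcases Nat.eq_zero_or_pos i with rfl | hipos
    · rw [hC, eval_C] at hHs₀
      exact absurd hi hHs₀.ne
    · rw [hC, coeff_C, if_neg hipos.ne', map_zero] at hi
      exact zero_ne_one hi
  | succ n ih =>
    intro H hdeg hint hunit s₀ hs₀ hHs₀
    -- if the degree is already `≤ n`, use the induction hypothesis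
    by_cases hdeg' : H.natDegree ≤ n
    · exact ih H hdeg' hint hunit s₀ hs₀ hHs₀
    have hN : H.natDegree = n + 1 := le_antisymm hdeg (not_le.mp hdeg')
    have hH0 : H ≠ 0 := by rintro rfl; simp at hN
    -- a root `r` of `H` in the algebraically closed field `L`
    obtain ⟨r, hr⟩ : ∃ r, H.IsRoot r := by
      refine IsAlgClosed.exists_root H ?_
      rw [degree_eq_natDegree hH0, hN]
      exact_mod_cast Nat.succ_ne_zero n
    have hfac : (X - C r) * (H /ₘ (X - C r)) = H := mul_divByMonic_eq_iff_isRoot.mpr hr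
    set H₁ := H /ₘ (X - C r) with hH₁def
    have hH₁deg : H₁.natDegree ≤ n := by
      have h := natDegree_divByMonic H (monic_X_sub_C r)
      rw [natDegree_X_sub_C] at h
      rw [hH₁def, h, hN]; omega
    by_cases hwr : w r ≤ 1
    · -- Case `w r ≤ 1`: `H₁` is integral
      have hint₁ : ∀ i, w (H₁.coeff i) ≤ 1 := val_coeff_divByMonic_X_sub_C_le_one hint hwr
      by_cases hrs : w (r - s₀) < 1
      · exact ⟨r, hwr, hrs, hr⟩
      · -- `s̄₀ ≠ r̄`: then `s̄₀` is a root of `H̄₁` and `H̄₁ ≠ 0`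
        have hrs1 : w (s₀ - r) = 1 := by
          rw [Valuation.map_sub_swap]
          refine le_antisymm ?_ (not_lt.mp hrs)
          rw [Valuation.map_sub_swap]
          exact (w.map_sub s₀ r).trans (max_le hs₀ hwr)
        have heval : H.eval s₀ = (s₀ - r) * H₁.eval s₀ := by
          conv_lhs => rw [← hfac]
          rw [eval_mul, eval_sub, eval_X, eval_C]
        have hH₁s₀ : w (H₁.eval s₀) < 1 := by
          have := hHs₀
          rwa [heval, map_mul, hrs1, one_mul] at this
        have hunit₁ : ∃ i, w (H₁.coeff i) = 1 := by
          by_contra hall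
          push Not at hall
          have hlt : ∀ i, w (H₁.coeff i) < 1 := fun i ↦ lt_of_le_of_ne (hint₁ i) (hall i)
          obtain ⟨i, hi⟩ := hunit
          have hcoeff : H.coeff i = (X * H₁).coeff i - r * H₁.coeff i := by
            conv_lhs => rw [← hfac]
            rw [sub_mul, coeff_sub, coeff_C_mul]
          have hXH : w ((X * H₁).coeff i) < 1 := by
            rcases i with _ | j
            · rw [coeff_X_mul_zero, map_zero]; exact zero_lt_one
            · rw [coeff_X_mul]; exact hlt j
          have : w (H.coeff i) < 1 := by
            rw [hcoeff]
            refine lt_of_le_of_lt (w.map_sub _ _) (max_lt hXH ?_)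
            rw [map_mul]
            calc w r * w (H₁.coeff i) ≤ 1 * w (H₁.coeff i) := by gcongr
              _ < 1 := by rw [one_mul]; exact hlt i
          exact absurd hi this.ne
        obtain ⟨s, hs, hss₀, hroot⟩ := ih H₁ hH₁deg hint₁ hunit₁ s₀ hs₀ hH₁s₀
        refine ⟨s, hs, hss₀, ?_⟩
        rw [← hfac, eval_mul, hroot, mul_zero]
    · -- Case `w r > 1`: `H = (1 - u X) · G` with `u = r⁻¹`, `G = -r · H₁`
      rw [not_le] at hwr
      have hr0 : r ≠ 0 := by rintro rfl; rw [map_zero] at hwr; exact not_lt_zero hwr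
      obtain ⟨u, hudef⟩ : ∃ u : L, u = r⁻¹ := ⟨_, rfl⟩
      have hu : w u < 1 := by
        rw [hudef, map_inv₀]; exact inv_lt_one_of_one_lt₀ hwr
      obtain ⟨G, hGdef⟩ : ∃ G : L[X], G = C (-r) * H₁ := ⟨_, rfl⟩
      have hCur : C u * C r = (1 : L[X]) := by
        rw [← C_mul, hudef, inv_mul_cancel₀ hr0, C_1]
      have hfacG : (1 - C u * X) * G = H := by
        rw [← hfac, hGdef]
        have e : (1 - C u * X) * C (-r) = X - C r := by
          rw [C_neg]
          linear_combination X * hCur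
        rw [← mul_assoc, e]
      -- the coefficient recursion `H_i = G_i - u (X G)_{i}`
      have hrec : ∀ i, H.coeff i = G.coeff i - u * (X * G).coeff i := by
        intro i
        conv_lhs => rw [← hfacG]
        rw [sub_mul, one_mul, coeff_sub, mul_assoc, coeff_C_mul]
      -- `G` is integral
      have hintG : ∀ i, w (G.coeff i) ≤ 1 := by
        intro i
        induction i with
        | zero =>
          have h0 := hrec 0
          rw [coeff_X_mul_zero, mul_zero, sub_zero] at h0
          exact h0 ▸ hint 0
        | succ j ihj =>
          have h := hrec (j + 1)
          rw [coeff_X_mul] at h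
          have : G.coeff (j + 1) = H.coeff (j + 1) + u * G.coeff j := by rw [h]; ring
          rw [this]
          refine (w.map_add _ _).trans (max_le (hint _) ?_)
          rw [map_mul]
          calc w u * w (G.coeff j) ≤ 1 * 1 := mul_le_mul' hu.le ihj
            _ = 1 := one_mul 1
      -- `Ḡ = H̄ ≠ 0`
      have huX : ∀ i, w (u * (X * G).coeff i) < 1 := by
        intro i
        rw [map_mul]
        rcases i with _ | j
        · rw [coeff_X_mul_zero, map_zero, mul_zero]; exact zero_lt_one
        · rw [coeff_X_mul]
          calc w u * w (G.coeff j) ≤ w u * 1 := by gcongr; exact hintG _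
            _ < 1 := by rw [mul_one]; exact hu
      have hunitG : ∃ i, w (G.coeff i) = 1 := by
        obtain ⟨i, hi⟩ := hunit
        refine ⟨i, ?_⟩
        have : G.coeff i = H.coeff i + u * (X * G).coeff i := by rw [hrec i]; ring
        rw [this, Valuation.map_add_eq_of_lt_left]
        · exact hi
        · rw [hi]; exact huX i
      -- `w (G(s₀)) < 1`
      have hGs₀ : w (G.eval s₀) < 1 := by
        have h1 : w (1 - u * s₀) = 1 := by
          refine w.map_one_sub_of_lt ?_
          rw [map_mul]
          calc w u * w s₀ ≤ w u * 1 := by gcongr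
            _ < 1 := by rw [mul_one]; exact hu
        have := hHs₀
        rw [← hfacG, eval_mul, eval_sub, eval_one, eval_mul, eval_C, eval_X, map_mul, h1,
          one_mul] at this
        exact this
      -- the degree of `G`
      have hGdeg : G.natDegree ≤ n := by
        rw [hGdef]
        refine (natDegree_C_mul_le _ _).trans hH₁deg
      obtain ⟨s, hs, hss₀, hroot⟩ := ih G hGdeg hintG hunitG s₀ hs₀ hGs₀
      refine ⟨s, hs, hss₀, ?_⟩
      rw [← hfacG, eval_mul, hroot, mul_zero]

/-! ## `E₁(L)` is `m`-divisible -/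

variable {V : WeierstrassCurve L}

/-- **The kernel of reduction is `m`-divisible for `|m| = 1`** (Silverman, *AEC* IV.3.2(b) with
IV.2.3(b) and VII.2.2: `[m] : E₁ ⥲ E₁` for `m ∈ R^*`; here by division polynomials).  Over an
algebraically closed valued field `(L, w)`, for a `w`-integral Weierstrass equation `V` which is an
elliptic curve, `m ∈ ℤ` with `w m = 1`, and an affine point `P = (x, y)` with `w x > 1` (i.e.
`P ∈ E₁(L)`), there is an affine point `Q = (x', y')` with `w x' > 1` and `m • Q = P`.
[cite: SilvermanAEC2009, Prop. IV.3.2(b) (first proof, PDF p. 116) with Prop. VII.2.2] -/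
theorem exists_zsmul_eq_of_one_lt_val [IsAlgClosed L] [hV : V.IsIntegral w.integer] [V.IsElliptic]
    {m : ℤ} (hm : w m = 1) {x y : L} (h : V.toAffine.Nonsingular x y) (hx : 1 < w x) :
    ∃ (x' y' : L) (h' : V.toAffine.Nonsingular x' y'), 1 < w x' ∧
      m • (Affine.Point.some x' y' h' : V.toAffine.Point) = Affine.Point.some x y h := by
  obtain ⟨M, hM⟩ := hV.integral
  -- numerology
  set d : ℕ := m.natAbs ^ 2 with hd
  have hm0 : m ≠ 0 := by rintro rfl; simp at hm
  have hd1 : 1 ≤ d := Nat.one_le_pow _ _ (Int.natAbs_pos.mpr hm0)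
  have hx0 : x ≠ 0 := by rintro rfl; rw [map_zero] at hx; exact not_lt_zero hx
  have hwx0 : w x ≠ 0 := (zero_lt_one.trans hx).ne'
  have hxinv : w x⁻¹ < 1 := by rw [map_inv₀]; exact inv_lt_one_of_one_lt₀ hx
  have hm2 : w ((m : L) ^ 2) = 1 := by rw [map_pow, hm, one_pow]
  -- the division polynomials of the integral model
  have hΦmap : V.Φ m = (M.Φ m).map (algebraMap w.integer L) := by
    rw [← map_Φ, hM, baseChange]
  have hΨmap : V.ΨSq m = (M.ΨSq m).map (algebraMap w.integer L) := by
    rw [← map_ΨSq, hM, baseChange]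
  have hΦint : ∀ i, w ((V.Φ m).coeff i) ≤ 1 := fun i ↦ by
    rw [hΦmap, coeff_map]; exact ((M.Φ m).coeff i).2
  have hΨint : ∀ i, w ((V.ΨSq m).coeff i) ≤ 1 := fun i ↦ by
    rw [hΨmap, coeff_map]; exact ((M.ΨSq m).coeff i).2
  have hΦtop : (V.Φ m).coeff d = 1 := V.coeff_Φ m
  have hΨtop : (V.ΨSq m).coeff (d - 1) = (m : L) ^ 2 := by
    have := V.coeff_ΨSq m; rwa [← hd] at this
  have hΨdeg : (V.ΨSq m).natDegree ≤ d - 1 := by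
    have := V.natDegree_ΨSq_le m; rwa [← hd] at this
  have hΨd : (V.ΨSq m).coeff d = 0 := by
    refine coeff_eq_zero_of_natDegree_lt (lt_of_le_of_lt hΨdeg ?_)
    omega
  -- `F(X) = Φₘ(X) - x ΨSqₘ(X)`, of degree `≤ d`
  set F : L[X] := V.Φ m - C x * V.ΨSq m with hFdef
  have hFcoeff : ∀ i, F.coeff i = (V.Φ m).coeff i - x * (V.ΨSq m).coeff i := fun i ↦ by
    rw [hFdef, coeff_sub, coeff_C_mul]
  have hFdeg : F.natDegree < d + 1 := by
    refine Nat.lt_succ_of_le ((natDegree_sub_le _ _).trans (max_le ?_ ?_))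
    · exact V.natDegree_Φ_le m
    · refine (natDegree_C_mul_le _ _).trans (hΨdeg.trans (Nat.sub_le d 1))
  -- `H(S) = x^{-d} F(x S)`
  set H : L[X] := ∑ i ∈ Finset.range (d + 1), C (F.coeff i / x ^ (d - i)) * X ^ i with hHdef
  have hHcoeff : ∀ i, H.coeff i = if i < d + 1 then F.coeff i / x ^ (d - i) else 0 := by
    intro i
    rw [hHdef, finsetSum_coeff]
    simp only [coeff_C_mul_X_pow]
    rw [Finset.sum_ite_eq]
    simp only [Finset.mem_range]
  have hHeval : ∀ s : L, F.eval (x * s) = x ^ d * H.eval s := by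
    intro s
    rw [eval_eq_sum_range' hFdeg, hHdef, eval_finsetSum, Finset.mul_sum]
    refine Finset.sum_congr rfl fun i hi ↦ ?_
    rw [Finset.mem_range] at hi
    rw [eval_mul, eval_C, eval_pow, eval_X, mul_pow]
    have hxd : x ^ d = x ^ (d - i) * x ^ i := by rw [← pow_add, Nat.sub_add_cancel (by omega)]
    have hxdi : x ^ (d - i) ≠ 0 := pow_ne_zero _ hx0
    rw [hxd]
    field_simp
  -- `H` is integral, with `H_d = 1`, `H_{d-1} ≡ -m²`, `H_i ≡ 0` for `i < d - 1`
  have hHd : H.coeff d = 1 := by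
    rw [hHcoeff, if_pos (Nat.lt_succ_self d), hFcoeff, hΦtop, hΨd, mul_zero, sub_zero,
      Nat.sub_self, pow_zero, div_one]
  have hHsmall : ∀ i, i < d → w (H.coeff i + (if i = d - 1 then (m : L) ^ 2 else 0)) < 1 := by
    intro i hi
    rw [hHcoeff, if_pos (Nat.lt_succ_of_lt hi), hFcoeff, sub_div]
    have hk : 1 ≤ d - i := by omega
    -- the `Φ`-part is small
    have h1 : w ((V.Φ m).coeff i / x ^ (d - i)) < 1 := by
      rw [map_div₀, map_pow]
      calc w ((V.Φ m).coeff i) / w x ^ (d - i) ≤ 1 / w x ^ (d - i) := by gcongr; exact hΦint i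
        _ < 1 := by
          rw [one_div]
          exact inv_lt_one_of_one_lt₀ (one_lt_pow₀ hx (by omega))
    -- the `ΨSq`-part is `m²` in degree `d - 1` and small below
    by_cases hid : i = d - 1
    · subst hid
      rw [if_pos rfl, hΨtop]
      have : x * (m : L) ^ 2 / x ^ (d - (d - 1)) = (m : L) ^ 2 := by
        rw [show d - (d - 1) = 1 by omega, pow_one, mul_div_cancel_left₀ _ hx0]
      rw [this, sub_add_cancel]
      exact h1
    · rw [if_neg hid, add_zero]
      refine lt_of_le_of_lt (w.map_sub _ _) (max_lt h1 ?_)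
      obtain ⟨k, hk1, hk⟩ : ∃ k, 1 ≤ k ∧ d - i = k + 1 := ⟨d - i - 1, by omega, by omega⟩
      rw [map_div₀, map_mul, map_pow, hk, pow_succ]
      calc w x * w ((V.ΨSq m).coeff i) / (w x ^ k * w x) ≤ w x * 1 / (w x ^ k * w x) := by
            gcongr; exact hΨint i
        _ = (w x ^ k)⁻¹ := by
            field_simp
        _ < 1 := inv_lt_one_of_one_lt₀ (one_lt_pow₀ hx (by omega))
  have hHint : ∀ i, w (H.coeff i) ≤ 1 := by
    intro i
    rcases lt_trichotomy i d with hi | rfl | hi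
    · by_cases hid : i = d - 1
      · have hs := hHsmall i hi
        rw [if_pos hid] at hs
        have : H.coeff i = (H.coeff i + (m : L) ^ 2) - (m : L) ^ 2 := by ring
        rw [this]
        exact (w.map_sub _ _).trans (max_le hs.le hm2.le)
      · have hs := hHsmall i hi
        rw [if_neg hid, add_zero] at hs
        exact hs.le
    · rw [hHd, map_one]
    · rw [hHcoeff]
      split_ifs with h'
      · rw [coeff_eq_zero_of_natDegree_lt (lt_of_lt_of_le hFdeg (by omega)), zero_div, map_zero]
        exact zero_le_one
      · rw [map_zero]; exact zero_le_one
  -- `w (H(m²)) < 1`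
  have hHs₀ : w (H.eval ((m : L) ^ 2)) < 1 := by
    have hHnat : H.natDegree < d + 1 := by
      refine Nat.lt_succ_of_le (natDegree_le_iff_coeff_eq_zero.mpr fun i hi ↦ ?_)
      rw [hHcoeff, if_neg (by omega)]
    rw [eval_eq_sum_range' hHnat, Finset.sum_range_succ]
    -- regroup: `Σ_{i<d} H_i s₀^i + s₀^d = Σ_{i<d} (H_i + [i = d-1] m²) s₀^i`
    have hregroup : ∑ i ∈ Finset.range d, (H.coeff i + if i = d - 1 then (m : L) ^ 2 else 0) *
          ((m : L) ^ 2) ^ i =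
        ∑ i ∈ Finset.range d, H.coeff i * ((m : L) ^ 2) ^ i + H.coeff d * ((m : L) ^ 2) ^ d := by
      have hsplit : ∀ i ∈ Finset.range d, (H.coeff i + if i = d - 1 then (m : L) ^ 2 else 0) *
          ((m : L) ^ 2) ^ i = H.coeff i * ((m : L) ^ 2) ^ i +
            (if i = d - 1 then (m : L) ^ 2 * ((m : L) ^ 2) ^ i else 0) := by
        intro i _; split_ifs <;> ring
      rw [Finset.sum_congr rfl hsplit, Finset.sum_add_distrib, Finset.sum_ite_eq', if_pos, hHd,
        one_mul, ← pow_succ', Nat.sub_add_cancel hd1]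
      rw [Finset.mem_range]; omega
    rw [← hregroup]
    refine w.map_sum_lt one_ne_zero fun i hi ↦ ?_
    rw [Finset.mem_range] at hi
    rw [map_mul, map_pow, hm2, one_pow, mul_one]
    exact hHsmall i hi
  -- lift the simple root `m²` of the reduction
  obtain ⟨s, hs1, hss₀, hHs⟩ := exists_root_val_sub_lt_one d H (by
      refine natDegree_le_iff_coeff_eq_zero.mpr fun i hi ↦ ?_
      rw [hHcoeff, if_neg (by omega)]) hHint ⟨d, by rw [hHd, map_one]⟩ ((m : L) ^ 2)
    hm2.le hHs₀
  have hws : w s = 1 := by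
    have : s = (m : L) ^ 2 + (s - (m : L) ^ 2) := by ring
    rw [this, w.map_add_eq_of_lt_left (by rw [hm2]; exact hss₀), hm2]
  -- the new `x`-coordinate
  set x' := x * s with hx'def
  have hx' : 1 < w x' := by rw [hx'def, map_mul, hws, mul_one]; exact hx
  have hF : F.eval x' = 0 := by rw [hx'def, hHeval, hHs, mul_zero]
  have hΨne : (V.ΨSq m).eval x' ≠ 0 := by
    intro h0
    have hval := val_eval_eq_pow hΨint hΨdeg (by rw [hΨtop, hm2]) hx'
    rw [h0, map_zero] at hval
    exact pow_ne_zero _ (zero_lt_one.trans hx').ne' hval.symm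
  have hΦΨ : (V.Φ m).eval x' = x * (V.ΨSq m).eval x' := by
    have := hF
    rw [hFdef, eval_sub, eval_mul, eval_C, sub_eq_zero] at this
    exact this
  -- an ordinate `y'` over `x'` (`L` is algebraically closed) and the point `Q = (x', y')`
  obtain ⟨y', hy'⟩ : ∃ y', V.toAffine.Equation x' y' := by
    obtain ⟨y', hy'⟩ := IsAlgClosed.exists_root
      (C 1 * X ^ 2 + C (V.a₁ * x' + V.a₃) * X + C (-(x' ^ 3 + V.a₂ * x' ^ 2 + V.a₄ * x' + V.a₆)))
      (by rw [degree_quadratic one_ne_zero]; exact two_ne_zero)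
    refine ⟨y', (Affine.equation_iff ..).mpr ?_⟩
    have e : y' ^ 2 + (V.a₁ * x' + V.a₃) * y' - (x' ^ 3 + V.a₂ * x' ^ 2 + V.a₄ * x' + V.a₆) = 0 := by
      have := hy'
      simp only [IsRoot.def, eval_add, eval_mul, eval_C, eval_pow, eval_X, one_mul] at this
      linear_combination this
    linear_combination e
  have hQ : V.toAffine.Nonsingular x' y' := Affine.equation_iff_nonsingular.mp hy'
  -- `[m]Q` has `x`-coordinate `Φₘ(x')/ΨSqₘ(x') = x`
  have hψ : (V.ψ m).evalEval x' y' ≠ 0 := by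
    intro h0
    apply hΨne
    rw [← V.evalEval_ψ_sq hy' m, h0, zero_pow two_ne_zero]
  obtain ⟨y₁, hns, hmQ⟩ := Affine.Point.zsmul_some_eq_some_φ_div hQ hψ
  have hx₁ : (V.φ m).evalEval x' y' / (V.ψ m).evalEval x' y' ^ 2 = x := by
    rw [V.evalEval_φ_eq_eval_Φ hy' m, V.evalEval_ψ_sq hy' m, hΦΨ, mul_div_cancel_right₀ _ hΨne]
  obtain ⟨hns', e'⟩ := UnivEC.some_eq_some_of_eq hx₁ rfl hns
  rw [e'] at hmQ
  -- so `[m]Q = ±P`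
  rcases (V.equation_iff_eq_or_eq_negY h.left y₁).mp hns'.left with hy₁ | hy₁
  · obtain ⟨h'', e''⟩ := UnivEC.some_eq_some_of_eq rfl hy₁ hns'
    refine ⟨x', y', hQ, hx', ?_⟩
    rw [hmQ, e'']
  · obtain ⟨h'', e''⟩ := UnivEC.some_eq_some_of_eq rfl hy₁ hns'
    refine ⟨x', V.toAffine.negY x' y', (Affine.nonsingular_neg ..).mpr hQ, hx', ?_⟩
    have e3 : (Affine.Point.some x' (V.toAffine.negY x' y') ((Affine.nonsingular_neg ..).mpr hQ) :
        V.toAffine.Point) = -Affine.Point.some x' y' hQ := by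
      rw [Affine.Point.neg_some]
    have e4 : (Affine.Point.some x (V.toAffine.negY x y) h'' : V.toAffine.Point) =
        -Affine.Point.some x y h := by
      rw [Affine.Point.neg_some]
    rw [e3, smul_neg, hmQ, e'', e4, neg_neg]

end Literature.NumberTheory.EllipticCurves

end
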